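import Literature.NumberTheory.GaloisCohomology.SelmerGroupFiniteProofs
import Literature.NumberTheory.GaloisCohomology.Howard2004.DVRKolyvaginBound
import Literature.NumberTheory.GaloisCohomology.Howard2004.PropagateUnramifiedProofs
import Literature.NumberTheory.GaloisRepresentations.CompleteLocalFiniteLevels
import HarnessLib

/-!
# Howard 2004, §1.6: the level Selmer groups `H¹_F(K, T^{(k)})` of a `DVRSetting` are finite —
# proofs file

Source: B. Howard, *The Heegner point Kolyvagin system*, Compositio Math. **140** (2004), §1.1
(conventions: the coefficient ring `R` is a complete Noetherian local ring with FINITE residue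
field, arXiv:1202.6340 p. 4 L47–52), Def. 1.1.10 (Selmer structures: `Σ(F)` finite, the finite =
unramified condition outside `Σ(F)`), H.0 (`T` free of rank two), §1.6 (the levels
`T^{(k)} = T/𝔪^{e_k} T` of the DVR setting).

For a `DVRSetting` `S` with H.0–H.5 (`S.SatisfiesH`) this file PROVES (sorry-free, no definition,
no named fact, no instance):

* `DVRSetting.finite_coeffLevel` — the level coefficient rings `R_k = R/𝔪^{e_k}` are finite
  (`R/𝔪^m` is finite for a Noetherian local ring with finite residue field,
  `CompleteLocalRing.finite_quotient_maximalIdeal_pow`, and `R → R_k` is onto with kernel `𝔪^{e_k}`);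
* `DVRSetting.finite_level` — the level modules `T^{(k)}` are finite (free of rank two over `R_k`,
  H.0);
* **`DVRSetting.finite_selmerGroup`** — the level Selmer groups `H¹_F(K, T^{(k)})` are finite:
  the generic finiteness of Selmer groups of finite Galois modules for Selmer structures
  unramified outside a finite set (`SelmerStructure.finite_selmerGroup_of_isUnramifiedOutside`,
  file `GaloisCohomology/SelmerGroupFiniteProofs`; Milne ADT I §6 / Silverman AEC X.4.3) applied to
  the Howard Selmer structure of the level triple (`(S.t k).isHoward.isUnramifiedOutside`).

This is the hypothesis «`H¹_F(K, T^{(k)})` finite» under which the levelwise structure package of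
Thm. 1.4.2 / Prop. 1.5.5 is assembled (it is used tacitly throughout Howard §1.4–1.6, where all
the modules `H¹_F(K, T^{(k)})` are finite `R_k`-modules).  HONEST FRAMING: bookkeeping; Howard's
Thm. 1.6.1 (`thm161_dvrKolyvaginBound`) is NOT proved here; nothing about BSD is claimed.
-/

noncomputable section

open Function NumberField IsDedekindDomain Field
open scoped NumberField Classical

namespace Literature.NumberTheory.GaloisCohomology.Howard2004

open Literature.NumberTheory.GaloisRepresentations
open Literature.NumberTheory.GaloisRepresentations.DiscreteGaloisModule

namespace DVRSetting

variable {p : ℕ} [Fact p.Prime] {K : Type} [Field K] [NumberField K]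
  {R : Type} [CommRing R] [IsDomain R] [IsDiscreteValuationRing R] [Algebra ℤ_[p] R]
  {N : ℕ → Type} [∀ k, AddCommGroup (N k)] [∀ k, TopologicalSpace (N k)]
  [∀ k, DiscreteTopology (N k)] [∀ k, Module R (N k)]
  {Rk : ℕ → Type} [∀ k, CommRing (Rk k)] [∀ k, IsLocalRing (Rk k)] [∀ k, TopologicalSpace (Rk k)]
  [∀ k, DiscreteTopology (Rk k)] [∀ k, Algebra ℤ_[p] (Rk k)] [∀ k, Algebra R (Rk k)]
  [∀ k, Module (Rk k) (N k)] [∀ k, IsScalarTower R (Rk k) (N k)]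
  {Nbar : Type} [AddCommGroup Nbar] [TopologicalSpace Nbar] [DiscreteTopology Nbar]
  [∀ k, Module (Rk k) Nbar]
  {Nq : ℕ → Finset (HeightOneSpectrum (𝓞 K)) → Type} [∀ k n, AddCommGroup (Nq k n)]
  [∀ k n, TopologicalSpace (Nq k n)] [∀ k n, DiscreteTopology (Nq k n)]
  [∀ k n, Module (Rk k) (Nq k n)] [∀ k n, Module R (Nq k n)]
  [∀ k n, IsScalarTower R (Rk k) (Nq k n)]

/-- **The level coefficient rings `R_k = R/𝔪^{e_k}` are finite.**  `R` is a coefficient ring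
(finite residue field, T1), so `R/𝔪^{e_k}` is finite, and `R → R_k` is surjective with kernel
`𝔪^{e_k}`. [cite: Howard2004HeegnerKolyvagin, §1.1 conventions (arXiv:1202.6340 p. 4, L47–52) and §1.6 (p. 11, L13–17)] -/
theorem finite_coeffLevel (S : DVRSetting p K R N Rk Nbar Nq) (hy : S.SatisfiesH) (k : ℕ) :
    Finite (Rk k) := by
  haveI : Finite (IsLocalRing.ResidueField R) := hy.coeffRing.finite_residueField
  haveI : Finite (R ⧸ IsLocalRing.maximalIdeal R ^ S.e k) :=
    CompleteLocalRing.finite_quotient_maximalIdeal_pow (R := R) (S.e k)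
  have hker : ∀ r ∈ IsLocalRing.maximalIdeal R ^ S.e k, algebraMap R (Rk k) r = 0 := by
    intro r hr
    rw [← hy.ker_algebraMap k] at hr
    exact hr
  refine Finite.of_surjective
    (Ideal.Quotient.lift (IsLocalRing.maximalIdeal R ^ S.e k) (algebraMap R (Rk k)) hker) ?_
  intro x
  obtain ⟨r, rfl⟩ := hy.algebraMap_surjective k x
  exact ⟨Ideal.Quotient.mk _ r, by rw [Ideal.Quotient.lift_mk]⟩

/-- **The level modules `T^{(k)} = T/𝔪^{e_k} T` are finite** (free of rank two over the finite ring
`R_k`, H.0). [cite: Howard2004HeegnerKolyvagin, H.0 (arXiv:1202.6340 p. 7, L57) and §1.6 (p. 11, L13–17)] -/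
theorem finite_level (S : DVRSetting p K R N Rk Nbar Nq) (hy : S.SatisfiesH) (k : ℕ) :
    Finite (N k) := by
  haveI : Finite (Rk k) := S.finite_coeffLevel hy k
  haveI : Module.Free (Rk k) (N k) := (hy.h0 k).1
  haveI : Module.Finite (Rk k) (N k) :=
    Module.finite_of_finrank_eq_succ (n := 1) (hy.h0 k).2
  exact Module.finite_of_finite (Rk k)

/-- **The level Selmer groups `H¹_F(K, T^{(k)})` of a `DVRSetting` are finite.**  `T^{(k)}` is a
finite Galois module (`finite_level`) and the level Selmer structure is unramified (= the finite
condition) outside the finite set `Σ(F)` (Def. 1.1.10, `IsHowardSelmerStructure.isUnramifiedOutside`),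
so the Selmer group is finite (`SelmerStructure.finite_selmerGroup_of_isUnramifiedOutside`; Milne
ADT I §6, Silverman AEC X.4.3).  This is the tacit finiteness of all the `H¹_F(K, T^{(k)})` in
Howard §1.4–1.6. [cite: Howard2004HeegnerKolyvagin, Def. 1.1.10 (arXiv:1202.6340 p. 6, L10–24) and §1.6 (p. 11, L13–38)] -/
theorem finite_selmerGroup (S : DVRSetting p K R N Rk Nbar Nq) (hy : S.SatisfiesH) (k : ℕ) :
    Finite ↥((S.t k).cond).selmerGroup := by
  haveI : Finite (N k) := S.finite_level hy k
  exact ((S.t k).cond).finite_selmerGroup_of_isUnramifiedOutside (S.t k).isHoward.isUnramifiedOutside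

end DVRSetting

end Literature.NumberTheory.GaloisCohomology.Howard2004

/-! ## Appendix (same session): the Selmer modules `𝓗(n) = H¹_{F(n)}(K, T/I_nT)` at every level `n`

Howard §1.5–1.6 runs the structure theory for ALL the modules `𝓗^{(k)}(n) = H¹_{F(n)}(K, T^{(k)})`
(`n ∈ 𝓝(𝓛^{(k)})`; in the tree: `LevelData.selmerAt D jbar n`, the Selmer group of the structure
`F(n)` — transverse at the primes of `n`, Def. 1.2.2 — propagated to the presentation of
`T/I_nT`, Def. 1.1.3).  These are finite as well: `F(n)` is a Howard Selmer structure with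
`Σ(F(n)) = Σ(F) ∪ {λ ∣ n}` (`SelmerTriple.atLevel`), its propagation to `T/I_nT` is again unramified
outside `Σ(F(n))` (`IsQuotientBy.propagateStructure_inr_eq_unramifiedSubgroup`: `T` is unramified
outside `Σ(F)` by Def. 1.1.10), and `T/I_nT` is finite with `T`. -/

namespace Literature.NumberTheory.GaloisCohomology.Howard2004

open Literature.NumberTheory.GaloisRepresentations
open Literature.NumberTheory.GaloisRepresentations.DiscreteGaloisModule

section AtLevel

variable {K : Type} [Field K] [NumberField K] {M : Type} [AddCommGroup M] [TopologicalSpace M]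
  [DiscreteTopology M] {R : Type} [CommRing R] [Module R M] {p : ℕ} [Fact p.Prime]
  {ρ : DiscreteGaloisModule K M} {t : SelmerTriple p ρ}
  {N : Finset (HeightOneSpectrum (𝓞 K)) → Type} [∀ n, AddCommGroup (N n)]
  [∀ n, TopologicalSpace (N n)] [∀ n, DiscreteTopology (N n)] [∀ n, Module R (N n)]

/-- **`F(n)` propagated to `T/I_nT` is unramified outside `Σ(F(n)) = Σ(F) ∪ {λ ∣ n}`**: at a finite
place `v ∉ Σ(F(n))` the condition of `F(n)` is `H¹_ur(K_v, T)` (Def. 1.1.10 / 1.2.2), `T` is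
unramified at `v` (Def. 1.1.10: `Σ(F)` contains the ramified places), and propagation along
`T ↠ T/I_nT` carries `H¹_ur(K_v, T)` onto `H¹_ur(K_v, T/I_nT)` (Mazur–Rubin Lemma 1.1.5 in the tree,
`IsQuotientBy.propagateStructure_inr_eq_unramifiedSubgroup`).
[cite: Howard2004HeegnerKolyvagin, Def. 1.1.3, Def. 1.1.10 and Def. 1.2.2 (arXiv:1202.6340 pp. 5–6)] -/
theorem LevelData.isUnramifiedOutside_propagateStructure_atLevel [Finite M] (D : LevelData R ρ t N)
    (jbar : AlgebraicClosure K →+* ℂ) (n : Finset (HeightOneSpectrum (𝓞 K))) :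
    ((D.isQuotientBy n).propagateStructure (t.atLevel jbar n).cond).IsUnramifiedOutside
      (t.atLevel jbar n).Sigma := by
  refine ⟨(t.atLevel jbar n).isHoward.isUnramifiedOutside.1, fun v hv => ?_⟩
  have hcond := (t.atLevel jbar n).isHoward.isUnramifiedOutside.2 v hv
  have hur : GaloisRep.IsUnramifiedAt v ρ := by
    by_contra h
    exact hv ((t.atLevel jbar n).isHoward.mem_of_ramified v h)
  exact (D.isQuotientBy n).propagateStructure_inr_eq_unramifiedSubgroup _ hcond hur

/-- **The Selmer modules `𝓗(n) = H¹_{F(n)}(K, T/I_nT)` are finite** for a finite `T` (every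
`n`): `LevelData.selmerAt D jbar n` is the Selmer group of a structure unramified outside the finite
set `Σ(F(n))` on the finite module `T/I_nT`
(`SelmerStructure.finite_selmerGroup_of_isUnramifiedOutside`).  These are the modules
`𝓗(n) ≅ R^ε ⊕ M(n) ⊕ M(n)` of §1.5 (display (structure decomposition), arXiv p. 10).
[cite: Howard2004HeegnerKolyvagin, Def. 1.2.3 (arXiv:1202.6340 p. 7, L1–6) and §1.5 (p. 10, L76–84)] -/
theorem LevelData.finite_selmerAt [Finite M] (D : LevelData R ρ t N)
    (jbar : AlgebraicClosure K →+* ℂ) (n : Finset (HeightOneSpectrum (𝓞 K))) :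
    Finite ↥(D.selmerAt jbar n) := by
  haveI : Finite (N n) := Finite.of_surjective _ (D.isQuotientBy n).surjective
  unfold LevelData.selmerAt
  exact ((D.isQuotientBy n).propagateStructure (t.atLevel jbar n).cond)
    |>.finite_selmerGroup_of_isUnramifiedOutside (D.isUnramifiedOutside_propagateStructure_atLevel jbar n)

end AtLevel

namespace DVRSetting

variable {p : ℕ} [Fact p.Prime] {K : Type} [Field K] [NumberField K]
  {R : Type} [CommRing R] [IsDomain R] [IsDiscreteValuationRing R] [Algebra ℤ_[p] R]
  {N : ℕ → Type} [∀ k, AddCommGroup (N k)] [∀ k, TopologicalSpace (N k)]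
  [∀ k, DiscreteTopology (N k)] [∀ k, Module R (N k)]
  {Rk : ℕ → Type} [∀ k, CommRing (Rk k)] [∀ k, IsLocalRing (Rk k)] [∀ k, TopologicalSpace (Rk k)]
  [∀ k, DiscreteTopology (Rk k)] [∀ k, Algebra ℤ_[p] (Rk k)] [∀ k, Algebra R (Rk k)]
  [∀ k, Module (Rk k) (N k)] [∀ k, IsScalarTower R (Rk k) (N k)]
  {Nbar : Type} [AddCommGroup Nbar] [TopologicalSpace Nbar] [DiscreteTopology Nbar]
  [∀ k, Module (Rk k) Nbar]
  {Nq : ℕ → Finset (HeightOneSpectrum (𝓞 K)) → Type} [∀ k n, AddCommGroup (Nq k n)]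
  [∀ k n, TopologicalSpace (Nq k n)] [∀ k n, DiscreteTopology (Nq k n)]
  [∀ k n, Module (Rk k) (Nq k n)] [∀ k n, Module R (Nq k n)]
  [∀ k n, IsScalarTower R (Rk k) (Nq k n)]

/-- **The modules `𝓗^{(k)}(n) = H¹_{F(n)}(K, T^{(k)}/I_n)` of a `DVRSetting` are finite** (every level
`k`, every `n`): the Selmer groups `(S.LD k).selmerAt S.jbar n` in which the Kolyvagin classes
`κ^{(k)}_n` live (Def. 1.2.3) — `T^{(k)}` is finite (`finite_level`) and `LevelData.finite_selmerAt`.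
[cite: Howard2004HeegnerKolyvagin, §1.6 (arXiv:1202.6340 p. 11, L29–38)] -/
theorem finite_selmerAt (S : DVRSetting p K R N Rk Nbar Nq) (hy : S.SatisfiesH) (k : ℕ)
    (n : Finset (HeightOneSpectrum (𝓞 K))) : Finite ↥((S.LD k).selmerAt S.jbar n) := by
  haveI : Finite (N k) := S.finite_level hy k
  exact (S.LD k).finite_selmerAt S.jbar n

/-- **The Selmer groups of the modified level triples `(T^{(k)}, F^a_b(c), 𝓛(abc))` are finite**
(Def. 1.2.2: relaxed at `a`, strict at `b`, transverse at `c`, `Σ = Σ(F) ∪ {λ ∣ abc}`) — in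
particular all the groups `𝓗^a_b(c)` of §1.5 read on `T^{(k)}` itself.
[cite: Howard2004HeegnerKolyvagin, Def. 1.2.2 (arXiv:1202.6340 p. 6, L101–125)] -/
theorem finite_selmerGroup_modify (S : DVRSetting p K R N Rk Nbar Nq) (hy : S.SatisfiesH) (k : ℕ)
    (a b c : Finset (HeightOneSpectrum (𝓞 K))) :
    Finite ↥(((S.t k).modify S.jbar a b c).cond).selmerGroup := by
  haveI : Finite (N k) := S.finite_level hy k
  exact (((S.t k).modify S.jbar a b c).cond).finite_selmerGroup_of_isUnramifiedOutside
    ((S.t k).modify S.jbar a b c).isHoward.isUnramifiedOutside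

end DVRSetting

end Literature.NumberTheory.GaloisCohomology.Howard2004
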